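import Summits.Ventures.QEC.Census.CSSZeroRate
import Summits.Ventures.QEC.Census.CSS.CalibCSSN01to04
import Summits.Ventures.QEC.Census.CSS.CalibCSSN05to06
import Summits.Ventures.QEC.Census.CSS.CalibCSSN07
import HarnessLib

/-!
# CSS census rows in the kernel, `k = 0` cells: `[[n, 0, d]]` (CRSS convention) for `css_n<N>_k0`, `1 ≤ n ≤ 12`

LADDER-QEC (venture cell `qec`), CENSUS-PREREG C.2, companion table census/search-5/css-n12/CSS-CALIB.tsv (qec-search-5),
family `calibCSS` of census/TABLE.tsv. The `k = 0` cells: for a CSS code with `rank H^X + rank H^Z = n` the code space is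
one state and the tabulated `d` is, by CRSS's convention ([CalderbankEtAl1998] §3, printed p. 10), the least weight of a
nonzero stabilizer `= min (d(A), d(B))`, `A = rs H^X`, `B = rs H^Z` (search-5 REPORT.md). Each row states, for the CSS
code of the LITERAL gens rows (type-02 `CSSCode.ofMatrices (rowMatrix n HX) (rowMatrix n HZ) _`, bit `j` = qubit `j` =
character `j` of the gens string), `IsAdditiveCode C.toSympCode 0 d ∧ ∃ v ∈ C.toSympCode, v ≠ 0 ∧ sympWeight v = d`
(lit-1's `IsAdditiveCode`, type-02's `CSSCode.toSympCode = rs H^X × rs H^Z`) and the CRSS existence predicate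
`AdditiveCodeExists n 0 d`, through `css_isAdditiveCode_zero_of_certs` (Census/CSSZeroRate.lean): commutation, two rank
certificates (type-02 `RankCert`) with `r_X + r_Z = n`, and two CLASSICAL distance certificates (ker `H^Z` = `rs H^X`,
ker `H^X` = `rs H^Z` by parity-check duality) in qec-type-10's `DistCert.sideOK` shape with empty stabilizer list —
every check one `decide`: tier KERNEL-std, axioms ⊆ {propext, Classical.choice, Quot.sound}, no quantum enumeration at
all. Certificates found and checked in-seat by qec-type-02's `emit_css_calib.py`. HONEST FRAMING: statements about the
12 explicit instances; optimality / coverage of the cells is search-5's CSS-LP sentence (COMPUTED), not claimed here.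
[folklore] throughout.
-/

namespace Summit.Ventures.QEC.Census.CSS

open Summit.Ventures.QEC.Census Literature.InformationTheory.QuantumCodes

/-- Commutation check of `css_n1_k0` (`decide`). [folklore] -/
theorem comm_css_n1_k0 : commOK 1 [] [1] = true := by
  decide

-- rank certificate of `H^X` of `css_n1_k0`: identical statement already landed as `rankX_css_n1_k1` (Summits.Ventures.QEC.Census.CSS.CalibCSSN01to04) — reused, not restated
/-- Rank certificate of `H^Z` of `css_n1_k0` accepted (`rank = 1`, `decide`). [folklore] -/
theorem rankZ_css_n1_k0 : ({ r := 1, pivots := [0], rinv := [1], dependent := [] } : RankCert).check 1 [1] = true := by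
  decide

/-- Classical distance certificate `d(ker H^X) = 1` for `css_n1_k0` (empty stabilizer list, `decide`). [folklore] -/
theorem sideZ_css_n1_k0 : DistCert.sideOK 1 [] [] { d := 1, witness := 1, nonmember := 1, found := [] } = true := by
  decide

/-- Census row `css_n1_k0` (family `calibCSS`, CENSUS-PREREG C.2, `k = 0` cell in CRSS's convention; gens census/search-5/css-n12/css_gens/css_n1_k0.txt, GENS-SHA matrix_sha256 `697915c6a83aa4a5…`, file_sha16 `1b8fed1651291a91`; certA `b9aeb24843c51db1` ∧ certB `99efc5b21a15a70f`, ref-1 signed; search-5 provenance: trivial CSS [[1,0,1]]). The stabilizer space `rs H^X × rs H^Z` of the CSS code with the LITERAL check rows `H^X = []`, `H^Z = [1]` (bitmasks, bit `j` = qubit `j`) is a `[[1, 0, 1]]` additive code (self-dual, every nonzero stabilizer has weight `≥ 1`) and has a stabilizer of weight exactly `1` — rank certificates `r_X = 0`, `r_Z = 1` (`r_X + r_Z = n`) and CLASSICAL distance certificates for `ker H^Z` / `ker H^X`, all by `decide`, through `css_isAdditiveCode_zero_of_certs` (Census/CSSZeroRate.lean) — tier KERNEL-std, no quantum enumeration.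 [folklore] -/
theorem isAdditiveCode_css_n1_k0 :
    IsAdditiveCode (CSSCode.ofMatrices (rowMatrix 1 []) (rowMatrix 1 [1])
      (comm_of_commOK comm_css_n1_k0)).toSympCode 0 1 ∧
      ∃ v ∈ (CSSCode.ofMatrices (rowMatrix 1 []) (rowMatrix 1 [1])
      (comm_of_commOK comm_css_n1_k0)).toSympCode, v ≠ 0 ∧ sympWeight v = 1 :=
  css_isAdditiveCode_zero_of_certs_zOnly comm_css_n1_k0 rankX_css_n1_k1 rankZ_css_n1_k0 (by decide) (by decide) sideZ_css_n1_k0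

/-- Commutation check of `css_n2_k0` (`decide`). [folklore] -/
theorem comm_css_n2_k0 : commOK 2 [3] [3] = true := by
  decide

-- rank certificate of `H^X` of `css_n2_k0`: statement already landed as `Summit.Ventures.QEC.Census.Seeds.rep2_rankCheck (Census/HGP/SeedsCore1.lean, qec-type-04)` — checked inline below, not restated
-- rank certificate of `H^Z` of `css_n2_k0`: statement already landed as `Summit.Ventures.QEC.Census.Seeds.rep2_rankCheck (Census/HGP/SeedsCore1.lean, qec-type-04)` — checked inline below, not restated
/-- Classical distance certificate `d(ker H^Z) = 2` for `css_n2_k0` (empty stabilizer list, `decide`). [folklore] -/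
theorem sideX_css_n2_k0 : DistCert.sideOK 2 [3] [] { d := 2, witness := 3, nonmember := 1, found := [] } = true := by
  decide

/-- Classical distance certificate `d(ker H^X) = 2` for `css_n2_k0` (empty stabilizer list, `decide`). [folklore] -/
theorem sideZ_css_n2_k0 : DistCert.sideOK 2 [3] [] { d := 2, witness := 3, nonmember := 1, found := [] } = true := by
  decide

/-- Census row `css_n2_k0` (family `calibCSS`, CENSUS-PREREG C.2, `k = 0` cell in CRSS's convention; gens census/search-5/css-n12/css_gens/css_n2_k0.txt, GENS-SHA matrix_sha256 `b14d0c6b5a481d56…`, file_sha16 `138ad2b2b864ede5`; certA `4a635f4fa6150a38` ∧ certB `6e208cb2dd20d177`, ref-1 signed; search-5 provenance: [[2,0,2]] A=B=<1^n>). The stabilizer space `rs H^X × rs H^Z` of the CSS code with the LITERAL check rows `H^X = [3]`, `H^Z = [3]` (bitmasks, bit `j` = qubit `j`) is a `[[2, 0, 2]]` additive code (self-dual, every nonzero stabilizer has weight `≥ 2`) and has a stabilizer of weight exactly `2` — rank certificates `r_X = 1`, `r_Z = 1` (`r_X + r_Z = n`) and CLASSICAL distance certificates for `ker H^Z` / `ker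 H^X`, all by `decide`, through `css_isAdditiveCode_zero_of_certs` (Census/CSSZeroRate.lean) — tier KERNEL-std, no quantum enumeration. [folklore] -/
theorem isAdditiveCode_css_n2_k0 :
    IsAdditiveCode (CSSCode.ofMatrices (rowMatrix 2 [3]) (rowMatrix 2 [3])
      (comm_of_commOK comm_css_n2_k0)).toSympCode 0 2 ∧
      ∃ v ∈ (CSSCode.ofMatrices (rowMatrix 2 [3]) (rowMatrix 2 [3])
      (comm_of_commOK comm_css_n2_k0)).toSympCode, v ≠ 0 ∧ sympWeight v = 2 :=
  css_isAdditiveCode_zero_of_certs comm_css_n2_k0 (cX := { r := 1, pivots := [0], rinv := [1], dependent := [] }) (cZ := { r := 1, pivots := [0], rinv := [1], dependent := [] }) (by decide) (by decide) (by decide) sideX_css_n2_k0 sideZ_css_n2_k0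

/-- Commutation check of `css_n3_k0` (`decide`). [folklore] -/
theorem comm_css_n3_k0 : commOK 3 [7] [5, 3] = true := by
  decide

/-- Rank certificate of `H^X` of `css_n3_k0` accepted (`rank = 1`, `decide`). [folklore] -/
theorem rankX_css_n3_k0 : ({ r := 1, pivots := [0], rinv := [1], dependent := [] } : RankCert).check 3 [7] = true := by
  decide

/-- Rank certificate of `H^Z` of `css_n3_k0` accepted (`rank = 2`, `decide`). [folklore] -/
theorem rankZ_css_n3_k0 : ({ r := 2, pivots := [0, 1], rinv := [3, 2], dependent := [] } : RankCert).check 3 [5, 3] = true := by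
  decide

/-- Classical distance certificate `d(ker H^Z) = 3` for `css_n3_k0` (empty stabilizer list, `decide`). [folklore] -/
theorem sideX_css_n3_k0 : DistCert.sideOK 3 [5, 3] [] { d := 3, witness := 7, nonmember := 1, found := [] } = true := by
  decide

/-- Classical distance certificate `d(ker H^X) = 2` for `css_n3_k0` (empty stabilizer list, `decide`). [folklore] -/
theorem sideZ_css_n3_k0 : DistCert.sideOK 3 [7] [] { d := 2, witness := 3, nonmember := 1, found := [] } = true := by
  decide

/-- Census row `css_n3_k0` (family `calibCSS`, CENSUS-PREREG C.2, `k = 0` cell in CRSS's convention; gens census/search-5/css-n12/css_gens/css_n3_k0.txt, GENS-SHA matrix_sha256 `b5f331877cb4c662…`, file_sha16 `57cba6bc39eda109`; certA `3335532e850c1b83` ∧ certB `b7cc1cca191fe6ca`, ref-1 signed; search-5 provenance: short_j0X(sub0(sub0([[4,2,2]] A=B=<1^n>)))). The stabilizer space `rs H^X × rs H^Z` of the CSS code with the LITERAL check rows `H^X = [7]`, `H^Z = [5, 3]` (bitmasks, bit `j` = qubit `j`) is a `[[3, 0, 2]]` additive code (self-dual, every nonzero stabilizer has weight `≥ 2`)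 and has a stabilizer of weight exactly `2` — rank certificates `r_X = 1`, `r_Z = 2` (`r_X + r_Z = n`) and CLASSICAL distance certificates for `ker H^Z` / `ker H^X`, all by `decide`, through `css_isAdditiveCode_zero_of_certs` (Census/CSSZeroRate.lean) — tier KERNEL-std, no quantum enumeration. [folklore] -/
theorem isAdditiveCode_css_n3_k0 :
    IsAdditiveCode (CSSCode.ofMatrices (rowMatrix 3 [7]) (rowMatrix 3 [5, 3])
      (comm_of_commOK comm_css_n3_k0)).toSympCode 0 2 ∧
      ∃ v ∈ (CSSCode.ofMatrices (rowMatrix 3 [7]) (rowMatrix 3 [5, 3])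
      (comm_of_commOK comm_css_n3_k0)).toSympCode, v ≠ 0 ∧ sympWeight v = 2 :=
  css_isAdditiveCode_zero_of_certs comm_css_n3_k0 rankX_css_n3_k0 rankZ_css_n3_k0 (by decide) sideX_css_n3_k0 sideZ_css_n3_k0

/-- Commutation check of `css_n4_k0` (`decide`). [folklore] -/
theorem comm_css_n4_k0 : commOK 4 [15] [9, 5, 3] = true := by
  decide

-- rank certificate of `H^X` of `css_n4_k0`: identical statement already landed as `rankX_css_n4_k1` (Summits.Ventures.QEC.Census.CSS.CalibCSSN01to04) — reused, not restated
/-- Rank certificate of `H^Z` of `css_n4_k0` accepted (`rank = 3`, `decide`). [folklore] -/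
theorem rankZ_css_n4_k0 : ({ r := 3, pivots := [0, 1, 2], rinv := [7, 4, 2], dependent := [] } : RankCert).check 4 [9, 5, 3] = true := by
  decide

/-- Classical distance certificate `d(ker H^Z) = 4` for `css_n4_k0` (empty stabilizer list, `decide`). [folklore] -/
theorem sideX_css_n4_k0 : DistCert.sideOK 4 [9, 5, 3] [] { d := 4, witness := 15, nonmember := 1, found := [] } = true := by
  decide

/-- Classical distance certificate `d(ker H^X) = 2` for `css_n4_k0` (empty stabilizer list, `decide`). [folklore] -/
theorem sideZ_css_n4_k0 : DistCert.sideOK 4 [15] [] { d := 2, witness := 3, nonmember := 1, found := [] } = true := by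
  decide

/-- Census row `css_n4_k0` (family `calibCSS`, CENSUS-PREREG C.2, `k = 0` cell in CRSS's convention; gens census/search-5/css-n12/css_gens/css_n4_k0.txt, GENS-SHA matrix_sha256 `3510fcd7b9d73955…`, file_sha16 `a3bcc5fcca3cb430`; certA `b5930687d419356c` ∧ certB `ade7142e4d93d521`, ref-1 signed; search-5 provenance: sub0(sub0([[4,2,2]] A=B=<1^n>))). The stabilizer space `rs H^X × rs H^Z` of the CSS code with the LITERAL check rows `H^X = [15]`, `H^Z = [9, 5, 3]` (bitmasks, bit `j` = qubit `j`) is a `[[4, 0, 2]]` additive code (self-dual, every nonzero stabilizer has weight `≥ 2`) and has a stabilizer of weight exactly `2` — rank certificates `r_X = 1`, `r_Z = 3` (`r_X + r_Z = n`) and CLASSICAL distance certificates for `ker H^Z` / `ker H^X`, all by `decide`, through `css_isAdditiveCode_zero_of_certs` (Census/CSSZeroRate.lean) — tier KERNEL-std, no quantum enumeration. [folklore] -/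
theorem isAdditiveCode_css_n4_k0 :
    IsAdditiveCode (CSSCode.ofMatrices (rowMatrix 4 [15]) (rowMatrix 4 [9, 5, 3])
      (comm_of_commOK comm_css_n4_k0)).toSympCode 0 2 ∧
      ∃ v ∈ (CSSCode.ofMatrices (rowMatrix 4 [15]) (rowMatrix 4 [9, 5, 3])
      (comm_of_commOK comm_css_n4_k0)).toSympCode, v ≠ 0 ∧ sympWeight v = 2 :=
  css_isAdditiveCode_zero_of_certs comm_css_n4_k0 rankX_css_n4_k1 rankZ_css_n4_k0 (by decide) sideX_css_n4_k0 sideZ_css_n4_k0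

/-- Commutation check of `css_n5_k0` (`decide`). [folklore] -/
theorem comm_css_n5_k0 : commOK 5 [21, 11] [19, 10, 7] = true := by
  decide

-- rank certificate of `H^X` of `css_n5_k0`: identical statement already landed as `rankX_css_n5_k1` (Summits.Ventures.QEC.Census.CSS.CalibCSSN05to06) — reused, not restated
/-- Rank certificate of `H^Z` of `css_n5_k0` accepted (`rank = 3`, `decide`). [folklore] -/
theorem rankZ_css_n5_k0 : ({ r := 3, pivots := [0, 1, 2], rinv := [5, 3, 4], dependent := [] } : RankCert).check 5 [19, 10, 7] = true := by
  decide

/-- Classical distance certificate `d(ker H^Z) = 3` for `css_n5_k0` (empty stabilizer list, `decide`). [folklore] -/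
theorem sideX_css_n5_k0 : DistCert.sideOK 5 [19, 10, 7] [] { d := 3, witness := 11, nonmember := 1, found := [] } = true := by
  decide

/-- Classical distance certificate `d(ker H^X) = 2` for `css_n5_k0` (empty stabilizer list, `decide`). [folklore] -/
theorem sideZ_css_n5_k0 : DistCert.sideOK 5 [21, 11] [] { d := 2, witness := 10, nonmember := 2, found := [] } = true := by
  decide

/-- Census row `css_n5_k0` (family `calibCSS`, CENSUS-PREREG C.2, `k = 0` cell in CRSS's convention; gens census/search-5/css-n12/css_gens/css_n5_k0.txt, GENS-SHA matrix_sha256 `3d8151f07d648bfb…`, file_sha16 `3e26eabe7fe9037f`; certA `3f74f9246af72325` ∧ certB `ba588d57661f76d3`, ref-1 signed; search-5 provenance: sub0(short_j0Z(short_j0X([[7,1,3]] Steane (A=B=[7,3,4] simplex; Steane96))))). The stabilizer space `rs H^X × rs H^Z` of the CSS code with the LITERAL check rows `H^X = [21, 11]`, `H^Z = [19, 10, 7]` (bitmasks, bit `j` = qubit `j`) is a `[[5, 0, 2]]` additive code (self-dual, every nonzero stabilizer has weight `≥ 2`) and has a stabilizer of weight exactly `2` — rank certificates `r_X = 2`,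 `r_Z = 3` (`r_X + r_Z = n`) and CLASSICAL distance certificates for `ker H^Z` / `ker H^X`, all by `decide`, through `css_isAdditiveCode_zero_of_certs` (Census/CSSZeroRate.lean) — tier KERNEL-std, no quantum enumeration. [folklore] -/
theorem isAdditiveCode_css_n5_k0 :
    IsAdditiveCode (CSSCode.ofMatrices (rowMatrix 5 [21, 11]) (rowMatrix 5 [19, 10, 7])
      (comm_of_commOK comm_css_n5_k0)).toSympCode 0 2 ∧
      ∃ v ∈ (CSSCode.ofMatrices (rowMatrix 5 [21, 11]) (rowMatrix 5 [19, 10, 7])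
      (comm_of_commOK comm_css_n5_k0)).toSympCode, v ≠ 0 ∧ sympWeight v = 2 :=
  css_isAdditiveCode_zero_of_certs comm_css_n5_k0 rankX_css_n5_k1 rankZ_css_n5_k0 (by decide) sideX_css_n5_k0 sideZ_css_n5_k0

/-- Commutation check of `css_n6_k0` (`decide`). [folklore] -/
theorem comm_css_n6_k0 : commOK 6 [37, 22, 15] [38, 21, 15] = true := by
  decide

-- rank certificate of `H^X` of `css_n6_k0`: identical statement already landed as `rankX_css_n6_k1` (Summits.Ventures.QEC.Census.CSS.CalibCSSN05to06) — reused, not restated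
/-- Rank certificate of `H^Z` of `css_n6_k0` accepted (`rank = 3`, `decide`). [folklore] -/
theorem rankZ_css_n6_k0 : ({ r := 3, pivots := [0, 1, 2], rinv := [5, 6, 7], dependent := [] } : RankCert).check 6 [38, 21, 15] = true := by
  decide

/-- Classical distance certificate `d(ker H^Z) = 3` for `css_n6_k0` (empty stabilizer list, `decide`). [folklore] -/
theorem sideX_css_n6_k0 : DistCert.sideOK 6 [38, 21, 15] [] { d := 3, witness := 37, nonmember := 1, found := [] } = true := by
  decide

/-- Classical distance certificate `d(ker H^X) = 3` for `css_n6_k0` (empty stabilizer list, `decide`). [folklore] -/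
theorem sideZ_css_n6_k0 : DistCert.sideOK 6 [37, 22, 15] [] { d := 3, witness := 21, nonmember := 1, found := [] } = true := by
  decide

/-- Census row `css_n6_k0` (family `calibCSS`, CENSUS-PREREG C.2, `k = 0` cell in CRSS's convention; gens census/search-5/css-n12/css_gens/css_n6_k0.txt, GENS-SHA matrix_sha256 `5eec64335fbd1af7…`, file_sha16 `b9235e2ec7e6aa0b`; certA `6a57d6bfe1ff0ece` ∧ certB `72ce85a701781667`, ref-1 signed; search-5 provenance: sub0(short_j0X([[7,1,3]] Steane (A=B=[7,3,4] simplex; Steane96)))). The stabilizer space `rs H^X × rs H^Z` of the CSS code with the LITERAL check rows `H^X = [37, 22, 15]`, `H^Z = [38, 21, 15]` (bitmasks, bit `j` = qubit `j`) is a `[[6, 0, 3]]` additive code (self-dual, every nonzero stabilizer has weight `≥ 3`) and has a stabilizer of weight exactly `3` — rank certificates `r_X = 3`, `r_Z = 3` (`r_X + r_Z = n`) and CLASSICAL distance certificates for `ker H^Z` / `ker H^X`, all by `decide`, through `css_isAdditiveCode_zero_of_certs` (Census/CSSZeroRate.lean) — tier KERNEL-std, no quantum enumeration. [folklore] -/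
theorem isAdditiveCode_css_n6_k0 :
    IsAdditiveCode (CSSCode.ofMatrices (rowMatrix 6 [37, 22, 15]) (rowMatrix 6 [38, 21, 15])
      (comm_of_commOK comm_css_n6_k0)).toSympCode 0 3 ∧
      ∃ v ∈ (CSSCode.ofMatrices (rowMatrix 6 [37, 22, 15]) (rowMatrix 6 [38, 21, 15])
      (comm_of_commOK comm_css_n6_k0)).toSympCode, v ≠ 0 ∧ sympWeight v = 3 :=
  css_isAdditiveCode_zero_of_certs comm_css_n6_k0 rankX_css_n6_k1 rankZ_css_n6_k0 (by decide) sideX_css_n6_k0 sideZ_css_n6_k0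

/-- Commutation check of `css_n7_k0` (`decide`). [folklore] -/
theorem comm_css_n7_k0 : commOK 7 [75, 45, 30] [75, 42, 25, 7] = true := by
  decide

-- rank certificate of `H^X` of `css_n7_k0`: identical statement already landed as `rankX_css_n7_k1` (Summits.Ventures.QEC.Census.CSS.CalibCSSN07) — reused, not restated
/-- Rank certificate of `H^Z` of `css_n7_k0` accepted (`rank = 4`, `decide`). [folklore] -/
theorem rankZ_css_n7_k0 : ({ r := 4, pivots := [0, 1, 2, 3], rinv := [11, 13, 14, 4], dependent := [] } : RankCert).check 7 [75, 42, 25, 7] = true := by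
  decide

/-- Classical distance certificate `d(ker H^Z) = 4` for `css_n7_k0` (empty stabilizer list, `decide`). [folklore] -/
theorem sideX_css_n7_k0 : DistCert.sideOK 7 [75, 42, 25, 7] [] { d := 4, witness := 75, nonmember := 1, found := [] } = true := by
  decide

/-- Classical distance certificate `d(ker H^X) = 3` for `css_n7_k0` (empty stabilizer list, `decide`). [folklore] -/
theorem sideZ_css_n7_k0 : DistCert.sideOK 7 [75, 45, 30] [] { d := 3, witness := 7, nonmember := 1, found := [] } = true := by
  decide

/-- Census row `css_n7_k0` (family `calibCSS`, CENSUS-PREREG C.2, `k = 0` cell in CRSS's convention; gens census/search-5/css-n12/css_gens/css_n7_k0.txt, GENS-SHA matrix_sha256 `74550743956abc1d…`, file_sha16 `a3511acb7ead8492`; certA `4e59e5cc54675039` ∧ certB `f3c8d357d45e86d3`, ref-1 signed; search-5 provenance: sub0([[7,1,3]] Steane (A=B=[7,3,4] simplex; Steane96))). The stabilizer space `rs H^X × rs H^Z` of the CSS code with the LITERAL check rows `H^X = [75, 45, 30]`, `H^Z = [75, 42, 25, 7]` (bitmasks, bit `j` = qubit `j`) is a `[[7, 0, 3]]` additive code (self-dual,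 every nonzero stabilizer has weight `≥ 3`) and has a stabilizer of weight exactly `3` — rank certificates `r_X = 3`, `r_Z = 4` (`r_X + r_Z = n`) and CLASSICAL distance certificates for `ker H^Z` / `ker H^X`, all by `decide`, through `css_isAdditiveCode_zero_of_certs` (Census/CSSZeroRate.lean) — tier KERNEL-std, no quantum enumeration. [folklore] -/
theorem isAdditiveCode_css_n7_k0 :
    IsAdditiveCode (CSSCode.ofMatrices (rowMatrix 7 [75, 45, 30]) (rowMatrix 7 [75, 42, 25, 7])
      (comm_of_commOK comm_css_n7_k0)).toSympCode 0 3 ∧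
      ∃ v ∈ (CSSCode.ofMatrices (rowMatrix 7 [75, 45, 30]) (rowMatrix 7 [75, 42, 25, 7])
      (comm_of_commOK comm_css_n7_k0)).toSympCode, v ≠ 0 ∧ sympWeight v = 3 :=
  css_isAdditiveCode_zero_of_certs comm_css_n7_k0 rankX_css_n7_k1 rankZ_css_n7_k0 (by decide) sideX_css_n7_k0 sideZ_css_n7_k0

end Summit.Ventures.QEC.Census.CSS
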